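import Summits.BirchSwinnertonDyer.Rank1Residual.SecondDescent.NonemptyCasselsTateFree
import Summits.BirchSwinnertonDyer.Rank1Residual.SecondDescent.BSDpFromSecondDescentEmpty
import Literature.NumberTheory.EllipticCurves.Rank1Residual.Typed.X5DescentSelmer
import HarnessLib

/-!
# The second-descent VERDICTS at Selmer level: `EMPTY` = "`ξ ∉ [p]_* Sel^(p²)`",
# `NONEMPTY(witness)` = "`[p]_* z = ξ`" (cell `b2b-bsdres`, CLASS-CLOSURE instrument B-1
# `SEL3CT-ALT`, seat cc-eng-4, GEN 18)

HONEST FRAMING (cell `b2b-bsdres`, run/shared/lean/b2b/bsd-rank1-residual/, verbatim in every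
file): the goal of the cell is to DELETE the COMBINATION-SHAPED residual classes of the
Birch–Swinnerton-Dyer formula for ALL analytic-rank `≤ 1` elliptic curves over `ℚ` — "full BSD
formula for every rank `≤ 1` curve in class `C`" assembled STRICTLY from published theorems — so
that the rank-`≤ 1` remainder becomes exactly the CONSTRUCTION-SHAPED classes, which are TYPED
(missing-input `Prop`s), NOT attempted. This is not "finishing BSD". Kernel TOOL theorems and
per-pair certificate SHAPES; NOT class theorems; no record filed; nothing booked (the lane books);
the second-descent outputs behind any record are INSTRUMENTATION (E4) / EVIDENCE under
census-lead's tier label. THEOREMS ONLY (no definition, no named fact, no `sorry`).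

## What this file does

`SelmerLevelCertificates` (GEN 15) moved the CLASS, the Mordell–Weil part and the INDEPENDENCE
datum of a B-1 record from `Ш(E/ℚ)` up to `Sel^(p)(E/ℚ) ⊆ H¹(ℚ, E[p])`, where the instrument holds
them; the VERDICT was still taken in `Ш` (`NONEMPTY`: `p • d = c`; `EMPTY`: `∀ d, p • d ≠ c`).
What the engines certify is one level up: for the cubic `C_ξ` of `ξ ∈ Sel^(p)(E/ℚ)`, Creutz's
second `p`-descent computes the `p`-Selmer SET of `C_ξ`, whose image in `Sel^(p²)(E/ℚ)` (composition
of covering maps) consists of `z` with `[p]_* z = ξ` and whose image in `Ш` is `{D : pD = [C_ξ]}`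
(Creutz 2014, Lemma 3.8 of §3.3 "Composite coverings", arXiv numbering). So a `NONEMPTY(witness)`
verdict EXHIBITS `z ∈ Sel^(p²)(E/ℚ)` with `[p]_* z = ξ`, and an EXACT `EMPTY` verdict certifies
`ξ ∉ [p]_* Sel^(p²)(E/ℚ)`. This file proves, in the tree's vocabulary (`WeierstrassCurve.selmerGroup`,
`selmerToSha` = `π_n : Sel^(n) → Ш`, `selmerZSMul` = `[m]_* : Sel^(n) → Sel^(d)`, all from
`Typed/X5DescentSelmer.lean`, unit sha-1), that these Selmer-level verdicts are EQUIVALENT to the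
`Ш`-level binders of every `SecondDescent/*` consumer, and restates the consumers with them:

* §1 abstract Kummer–Selmer diagram `(S, T, X, π, ρ, d)`, `π ∘ d = m • ρ`, `T ↠ X[n·m]`,
  `ker π ⊆ d(T)`, ARBITRARY levels `m, n : ℤ` (the `4 ∣ 8` lemmas of `Typed/X5DescentItem.lean`
  generalised): `zsmul_divisible_of_exists_eq`, `not_zsmul_divisible_of_not_exists_eq` (load-bearing:
  `s ∉ d(T)`, `n • π s = 0` ⇒ `π s ∉ m • X`), `zsmul_divisible_iff_exists_eq`, `ne_zero_of_not_exists_eq`.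
* §2 any number field, `E/K` elliptic, `d · m = n ≠ 0`: `sha_zsmul_divisible_iff_exists_selmerZSMul_eq`
  (`π_d s ∈ m • Ш ⟺ s ∈ [m]_* Sel^(n)`), `forall_zsmul_ne_selmerToSha_of_not_exists_selmerZSMul_eq`
  (EXACT `EMPTY` ⇒ `∀ w, m • w ≠ π_d s`), `selmerToSha_ne_zero_of_not_exists_selmerZSMul_eq`,
  `exists_selmerZSMul_eq_iff_of_selmerToSha_eq` (the verdict is constant on Mordell–Weil cosets),
  and the prime-level `ℕ`-scalar forms the consumers take.
* §3 `E/ℚ`, analytic rank `≤ 1`: `EMPTY` ⇒ `BSD(E,p)` with the binder `¬ ∃ z ∈ Sel^(p²), [p]_* z = s`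
  (`bsdp_of_card_selmer_of_casselsTate_of_not_exists_selmerZSMul_eq`; GZK + Cassels–Tate);
  `NONEMPTY × 2` with LIFTS `z₁, z₂ ∈ Sel^(p²)` ⇒ the typed LOWER half, NO Cassels–Tate (GEN 17)
  (`missingLowerBoundAt_of_two_selmerZSMul_eq_rankZero`, `…_mwLine`). §4 `p = 3`, literal levels
  `3 ∣ 9`: the two `EMPTY` record shapes (N11 atoms / X10a′ rank zero; X11b@3 rank one) and the X8
  `NONEMPTY × 2` class pattern.

RUNBOOK reading (numbers, not adjectives): (a) the EVIDENCE binder of a B-1 record is now LITERALLY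
the engine output — `EMPTY`: `¬ ∃ z ∈ Sel^(9)(E/ℚ), [3]_* z = ξ` for the cubic's own `ξ`;
`NONEMPTY`: the exhibited `z` (the `(e, δ, ε)` witness IS a `9`-covering above `C_ξ`); (b) a verdict
on `C_ξ` is the divisibility-by-`3` bit of `π₃(ξ) ∈ Ш(E/ℚ)[3]`, no more, no less; it is constant on
`ξ + κ(E(ℚ))`, so at rank `1` ONE cubic per `Ш`-class suffices and `mwrule.py` admissibility is an
efficiency filter, not a soundness condition; an `EMPTY` verdict forces `π₃(ξ) ≠ 0` by itself;
(c) named facts unchanged: `EMPTY` roads GZK + Cassels–Tate, `NONEMPTY × 2` roads GZK + upper half.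

References: Creutz, *Second p-descents on elliptic curves*, Math. Comp. 83 (2014), §1 and §3.3
Lemma 3.8 [Creutz2014]; Silverman *AEC* VIII.§2, X.4.2(a), X.4.14 [SilvermanAEC2009]; Stamminger
2005 §1.3 [Stamminger2005]; Schaefer–Stoll 2004 §§5–6 [SchaeferStoll2004]; Miller 2011 Def. 1.1
[Miller2011LMS]; tree `Typed/X5DescentSelmer.lean`, `Typed/X5DescentItem.lean` (unit sha-1: the
`p = 2`, levels `4 ∣ 8` instance of the same dictionary).
-/

noncomputable section

open scoped Classical

open WeierstrassCurve Literature.NumberTheory.EllipticCurves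
open Literature.NumberTheory.EllipticCurves.Rank1Residual
open Literature.NumberTheory.EllipticCurves.Rank1Residual.Typed
open Literature.NumberTheory.EllipticCurves.Wuthrich2014

namespace Summit.BirchSwinnertonDyer.Rank1Residual.SecondDescent

/-! ### §1. The Kummer–Selmer diagram at arbitrary levels, abstractly -/

section Diagram

variable {S T X : Type*} [AddCommGroup S] [AddCommGroup T] [AddCommGroup X]
  (π : S →+ X) (ρ : T →+ X) (d : T →+ S) {m n : ℤ}

/-- **A lift gives a divisible class** (functoriality alone): over additive groups `S, T, X` with
maps `π : S → X`, `ρ : T → X`, `d : T → S` and `π (d z) = m • ρ z`, if `d z = s` then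
`m • ρ z = π s` — the `NONEMPTY(witness)` reading: the class of the exhibited `p²`-covering `z` is the
`d` with `p • d = c`. [cite: SilvermanAEC2009, Thm. X.4.2(a)] [cite: Creutz2014, §1] -/
theorem zsmul_eq_of_eq (hcomm : ∀ z : T, π (d z) = m • ρ z) {z : T} {s : S} (hz : d z = s) :
    m • ρ z = π s := by
  rw [← hz, hcomm]

/-- **`s ∈ d(T)` ⇒ `π s ∈ m • X`** (functoriality alone). [cite: SilvermanAEC2009, Thm. X.4.2(a)] -/
theorem zsmul_divisible_of_exists_eq (hcomm : ∀ z : T, π (d z) = m • ρ z) {s : S}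
    (hs : ∃ z : T, d z = s) : ∃ w : X, m • w = π s := by
  obtain ⟨z, hz⟩ := hs
  exact ⟨ρ z, zsmul_eq_of_eq π ρ d hcomm hz⟩

/-- **The load-bearing direction: `s ∉ d(T)` ⇒ `π s ∉ m • X`** (`hcomm`: `π ∘ d = m • ρ`; `hsurj`:
`ρ` onto `X[n·m]`; `hker`: `ker π ⊆ d(T)`; `n • π s = 0`). Proof: `m • w = π s` gives `(n·m) • w = 0`,
a lift `ρ z = w`, `π (s - d z) = 0`, `s - d z = d z'`, `s = d (z' + z)`. For `(Sel^(p), Sel^(p²), Ш,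
[p]_*)`: an EXACT `EMPTY` verdict on the covering of `s` ⇒ its class is not a `p`-th multiple in
`Ш`, at any rank. [cite: SilvermanAEC2009, Thm. X.4.2(a)] [cite: Creutz2014, §1] [cite: Stamminger2005, §1.3] -/
theorem not_zsmul_divisible_of_not_exists_eq (hcomm : ∀ z : T, π (d z) = m • ρ z)
    (hsurj : ∀ w : X, (n * m) • w = 0 → ∃ z : T, ρ z = w)
    (hker : ∀ s : S, π s = 0 → ∃ z : T, d z = s)
    {s : S} (hs0 : n • π s = 0) (hs : ¬ ∃ z : T, d z = s) :
    ¬ ∃ w : X, m • w = π s := by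
  rintro ⟨w, hw⟩
  have hnm : (n * m) • w = 0 := by rw [mul_smul, hw, hs0]
  obtain ⟨z, hz⟩ := hsurj w hnm
  have hz' : π (s - d z) = 0 := by rw [map_sub, hcomm, hz, hw, sub_self]
  obtain ⟨z', hz''⟩ := hker _ hz'
  exact hs ⟨z' + z, by rw [map_add, hz'', sub_add_cancel]⟩

/-- **`π s ∈ m • X ⟺ s ∈ d(T)`** over the Kummer–Selmer diagram (`hcomm`, `hsurj`, `hker`) for
`n • π s = 0`: being `m` times a class is a property of the covering `s` itself. For
`(Sel^(p), Sel^(p²), Ш)` this is the tree side of Creutz's dictionary "the `p`-Selmer set of `C_ξ`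
is non-empty iff `ξ` is divisible by `p` in `Sel^(p²)`" ⟺ "the class of `C_ξ` is divisible by `p`
in `Ш`". [cite: Creutz2014, §3.3 Lemma 3.8 (arXiv:1209.3085 numbering)]
[cite: SilvermanAEC2009, Thm. X.4.2(a)] -/
theorem zsmul_divisible_iff_exists_eq (hcomm : ∀ z : T, π (d z) = m • ρ z)
    (hsurj : ∀ w : X, (n * m) • w = 0 → ∃ z : T, ρ z = w)
    (hker : ∀ s : S, π s = 0 → ∃ z : T, d z = s) {s : S} (hs0 : n • π s = 0) :
    (∃ w : X, m • w = π s) ↔ ∃ z : T, d z = s := by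
  constructor
  · intro h
    by_contra hs
    exact not_zsmul_divisible_of_not_exists_eq π ρ d hcomm hsurj hker hs0 hs h
  · exact zsmul_divisible_of_exists_eq π ρ d hcomm

end Diagram

/-! ### §2. The tree's Selmer groups over a number field: `π_d s ∈ m • Ш ⟺ s ∈ [m]_* Sel^(n)` -/

section NumberField

variable {K : Type*} [Field K] [NumberField K] (W : WeierstrassCurve K)

/-- **`NONEMPTY(witness)` at Selmer level ⇒ the `Ш`-level binder**: for levels `n ∣ d·m` and
`z ∈ Sel^(n)(E/K)` with `[m]_* z = s ∈ Sel^(d)(E/K)`, the classes satisfy `m • π_n z = π_d s` in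
`Ш(E/K)` (`selmerToSha_selmerZSMul`, functoriality of `H¹`). No hypothesis on `E`.
[cite: SilvermanAEC2009, Thm. X.4.2(a)] [cite: Stamminger2005, §1.3] -/
theorem zsmul_selmerToSha_eq_of_selmerZSMul_eq {d n : ℤ} {m : ℤ} {hm : n ∣ d * m}
    {z : W.selmerGroup n} {s : W.selmerGroup d} (hz : W.selmerZSMul m hm z = s) :
    m • W.selmerToSha n z = W.selmerToSha d s :=
  zsmul_eq_of_eq (W.selmerToSha d) (W.selmerToSha n) (W.selmerZSMul m hm)
    (fun z ↦ W.selmerToSha_selmerZSMul m hm z) hz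

/-- **The dictionary `π_d s ∈ m • Ш(E/K) ⟺ s ∈ [m]_* Sel^(n)(E/K)`** (`E/K` elliptic,
`d · m = n ≠ 0`), from sha-1's PROVED `selmerToSha_selmerZSMul` (functoriality),
`exists_selmerToSha_eq` (`Sel^(n) ↠ Ш[n]`, Silverman X.4.2(a)), `exists_selmerZSMul_eq_of_selmerToSha_eq_zero`
(`ker π_d = κ_d(E(K)) = [m]_* κ_n(E(K))`, VIII.§2) and `zsmul_selmerToSha`. With `d = m = p`, `n = p²`
it is the tree side of Creutz's Lemma 3.8 (the image of `Sel^(p)(C_ξ/K)` in `Ш(E/K)[p²]` is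
`{D : pD = [C_ξ]}`, so `Sel^(p)(C_ξ) ≠ ∅` iff `[C_ξ] ∈ pШ` iff `ξ ∈ [p]_* Sel^(p²)`).
[cite: Creutz2014, §3.3 Lemma 3.8 (arXiv:1209.3085 numbering)]
[cite: SilvermanAEC2009, VIII.§2 and Thm. X.4.2(a)] [cite: Stamminger2005, §1.3] -/
theorem sha_zsmul_divisible_iff_exists_selmerZSMul_eq [W.IsElliptic] {d n : ℤ} {m : ℤ}
    (hmn : d * m = n) (hn : n ≠ 0) (hm : n ∣ d * m) (s : W.selmerGroup d) :
    (∃ w : W.sha, m • w = W.selmerToSha d s) ↔ ∃ z : W.selmerGroup n, W.selmerZSMul m hm z = s := by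
  refine zsmul_divisible_iff_exists_eq (W.selmerToSha d) (W.selmerToSha n) (W.selmerZSMul m hm)
    (n := d) (fun z ↦ W.selmerToSha_selmerZSMul m hm z) (fun w hw ↦ ?_) (fun s' hs' ↦ ?_)
    (W.zsmul_selmerToSha d s)
  · exact W.exists_selmerToSha_eq hn w (by rw [← hmn]; exact hw)
  · obtain ⟨z, hz⟩ := W.exists_selmerZSMul_eq_of_selmerToSha_eq_zero m hmn hn s' hs'
    exact ⟨z, hz⟩

/-- **EXACT `EMPTY` at Selmer level ⇒ the `Ш`-level `EMPTY` binder** (`E/K` elliptic,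
`d · m = n ≠ 0`): if NO `z ∈ Sel^(n)(E/K)` has `[m]_* z = s`, then NO class `w ∈ Ш(E/K)` has
`m • w = π_d s` — the binder `hndiv` of the `EMPTY` consumers (`BSDpFromSecondDescentEmpty`) from
the engine's own statement. [cite: Creutz2014, §1] [cite: SilvermanAEC2009, Thm. X.4.2(a)] -/
theorem forall_zsmul_ne_selmerToSha_of_not_exists_selmerZSMul_eq [W.IsElliptic] {d n : ℤ} {m : ℤ}
    (hmn : d * m = n) (hn : n ≠ 0) {hm : n ∣ d * m} {s : W.selmerGroup d}
    (hs : ¬ ∃ z : W.selmerGroup n, W.selmerZSMul m hm z = s) :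
    ∀ w : W.sha, m • w ≠ W.selmerToSha d s := by
  intro w hw
  exact ((sha_zsmul_divisible_iff_exists_selmerZSMul_eq W hmn hn hm s).not.mpr hs) ⟨w, hw⟩

/-- **`EMPTY` forces a Ш-type covering**: with `d · m = n ≠ 0`, a Selmer element `s ∈ Sel^(d)(E/K)`
outside `[m]_* Sel^(n)(E/K)` has NON-ZERO class `π_d s ∈ Ш(E/K)` (`s ∉ κ_d(E(K))`): Mordell–Weil
classes are never `EMPTY`. [cite: Creutz2014, §1] [cite: SilvermanAEC2009, VIII.§2 and Thm. X.4.2(a)] -/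
theorem selmerToSha_ne_zero_of_not_exists_selmerZSMul_eq [W.IsElliptic] {d n : ℤ} {m : ℤ}
    (hmn : d * m = n) (hn : n ≠ 0) {hm : n ∣ d * m} {s : W.selmerGroup d}
    (hs : ¬ ∃ z : W.selmerGroup n, W.selmerZSMul m hm z = s) : W.selmerToSha d s ≠ 0 := by
  intro h0
  exact forall_zsmul_ne_selmerToSha_of_not_exists_selmerZSMul_eq W hmn hn hs 0
    (by rw [smul_zero, h0])

/-- **The divisibility bit is constant on Mordell–Weil cosets**: with `d · m = n ≠ 0`, if
`π_d s = π_d s'` (the two `d`-coverings differ by a Kummer class `κ_d(P)`) then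
`s ∈ [m]_* Sel^(n) ⟺ s' ∈ [m]_* Sel^(n)`: at rank `1` the cubics of `ξ` and `ξ ± δ(P)` return
the SAME verdict. [cite: Creutz2014, §1] [cite: SilvermanAEC2009, VIII.§2 and Thm. X.4.2(a)] -/
theorem exists_selmerZSMul_eq_iff_of_selmerToSha_eq [W.IsElliptic] {d n : ℤ} {m : ℤ}
    (hmn : d * m = n) (hn : n ≠ 0) (hm : n ∣ d * m) {s s' : W.selmerGroup d}
    (h : W.selmerToSha d s = W.selmerToSha d s') :
    (∃ z : W.selmerGroup n, W.selmerZSMul m hm z = s) ↔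
      ∃ z : W.selmerGroup n, W.selmerZSMul m hm z = s' := by
  rw [← sha_zsmul_divisible_iff_exists_selmerZSMul_eq W hmn hn hm s,
    ← sha_zsmul_divisible_iff_exists_selmerZSMul_eq W hmn hn hm s', h]

/-! #### Prime level `p ∣ p²` with `ℕ`-scalars (the form the `SecondDescent/*` consumers take) -/

/-- Arithmetic side condition `p² ∣ p·p` for `[p]_* : Sel^(p²) → Sel^(p)` (content-free). -/
theorem sq_dvd_mul_self (p : ℕ) : ((p ^ 2 : ℕ) : ℤ) ∣ (p : ℤ) * (p : ℤ) :=
  ⟨1, by push_cast; ring⟩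

/-- **`NONEMPTY(witness)`, prime level, `ℕ`-scalars**: `z ∈ Sel^(p²)(E/K)` with `[p]_* z = s`
gives `p • π_{p²} z = π_p s` in `Ш(E/K)` — the binder `hd : p • d = c` of the `NONEMPTY` consumers
with `d := π_{p²} z`, `c := π_p s`. [cite: Creutz2014, §1] [cite: SilvermanAEC2009, Thm. X.4.2(a)] -/
theorem nsmul_selmerToSha_sq_eq_of_selmerZSMul_eq (p : ℕ)
    {hm : ((p ^ 2 : ℕ) : ℤ) ∣ (p : ℤ) * (p : ℤ)} {z : W.selmerGroup ((p ^ 2 : ℕ) : ℤ)}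
    {s : W.selmerGroup (p : ℤ)} (hz : W.selmerZSMul (p : ℤ) hm z = s) :
    p • W.selmerToSha ((p ^ 2 : ℕ) : ℤ) z = W.selmerToSha (p : ℤ) s := by
  rw [← natCast_zsmul]
  exact zsmul_selmerToSha_eq_of_selmerZSMul_eq W hz

/-- **EXACT `EMPTY`, prime level, `ℕ`-scalars** (`E/K` elliptic, `p ≠ 0`): `s ∈ Sel^(p)(E/K)` with
NO `z ∈ Sel^(p²)(E/K)`, `[p]_* z = s` ⇒ `∀ w ∈ Ш(E/K), p • w ≠ π_p s` — verbatim the binder `hndiv`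
of the `EMPTY` consumers. [cite: Creutz2014, §1] [cite: SilvermanAEC2009, Thm. X.4.2(a)] -/
theorem forall_nsmul_ne_selmerToSha_of_not_exists_selmerZSMul_sq_eq [W.IsElliptic] {p : ℕ}
    (hp : p ≠ 0) {hm : ((p ^ 2 : ℕ) : ℤ) ∣ (p : ℤ) * (p : ℤ)} {s : W.selmerGroup (p : ℤ)}
    (hs : ¬ ∃ z : W.selmerGroup ((p ^ 2 : ℕ) : ℤ), W.selmerZSMul (p : ℤ) hm z = s) :
    ∀ w : W.sha, p • w ≠ W.selmerToSha (p : ℤ) s := by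
  intro w
  rw [← natCast_zsmul]
  exact forall_zsmul_ne_selmerToSha_of_not_exists_selmerZSMul_eq W (by push_cast; ring)
    (by exact_mod_cast pow_ne_zero 2 hp) hs w

/-- **`π_p s` is `p`-torsion with `ℕ`-scalars** (`p • π_p s = 0`; `zsmul_selmerToSha`) — the binder
`hpc : p • c = 0` of the `EMPTY` consumers. [cite: SilvermanAEC2009, Thm. X.4.2(a)] -/
theorem nsmul_selmerToSha_eq_zero (p : ℕ) (s : W.selmerGroup (p : ℤ)) :
    p • W.selmerToSha (p : ℤ) s = 0 := by
  rw [← natCast_zsmul]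
  exact W.zsmul_selmerToSha (p : ℤ) s

end NumberField

/-! ### §3. Over `ℚ`, analytic rank `≤ 1`: the consumers of record with Selmer-level VERDICT binders -/

section OverQ

variable (W : WeierstrassCurve ℚ) [W.IsElliptic] (p : ℕ) [hp : Fact p.Prime]

/-- **`EMPTY` at Selmer level ⇒ `BSD(E,p)`** (= `bsdp_of_card_selmer_of_casselsTate_of_not_divisible`
with `c := π_p s`, `hpc` / `hndiv` DERIVED): GZK, Cassels–Tate; `r_an ≤ 1`; `#E(ℚ)[p] = b`;
`#Sel^(p)(E/ℚ) = p^{r_an} · b · p²` (EXACT); ONE `s ∈ Sel^(p)(E/ℚ)` with NO `z ∈ Sel^(p²)(E/ℚ)`,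
`[p]_* z = s` (EXACT `EMPTY` on the covering of `s`); `ord_p #Ш_an = 2`. Per pair; nothing booked.
[cite: Creutz2014, §1] [cite: SilvermanAEC2009, Thm. X.4.2(a) and Thm. X.4.14] [cite: Miller2011LMS, Def. 1.1] -/
theorem bsdp_of_card_selmer_of_casselsTate_of_not_exists_selmerZSMul_eq
    (hGZK : rank_eq_analyticRank_of_analyticRank_le_one)
    (hCT : exists_casselsTate_pairing (K := ℚ)) (hr : W.analyticRank ≤ 1) {b : ℕ}
    (htors : Nat.card (AddSubgroup.torsionBy W.toAffine.Point (p : ℤ)) = b) (hb : 0 < b)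
    (hSel : Nat.card (W.selmerGroup (p : ℤ)) = p ^ W.analyticRank * b * p ^ 2)
    {hm : ((p ^ 2 : ℕ) : ℤ) ∣ (p : ℤ) * (p : ℤ)} (s : W.selmerGroup (p : ℤ))
    (hs : ¬ ∃ z : W.selmerGroup ((p ^ 2 : ℕ) : ℤ), W.selmerZSMul (p : ℤ) hm z = s)
    {q : ℚ} (hq : shaAn W = (q : ℂ)) (hv : padicValRat p q = 2) : BSDp W p :=
  bsdp_of_card_selmer_of_casselsTate_of_not_divisible W p hGZK hCT hr htors hb hSel
    (nsmul_selmerToSha_eq_zero W p s)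
    (forall_nsmul_ne_selmerToSha_of_not_exists_selmerZSMul_sq_eq W hp.out.ne_zero hs) hq hv

/-- **`NONEMPTY × 2` at Selmer level, `r_an = 0`, NO Cassels–Tate ⇒ the typed LOWER half** (=
`missingLowerBoundAt_of_two_nonempty_selmer_rankZero`, GEN 17, with `cᵢ := π_p sᵢ`, `dᵢ := π_{p²} zᵢ`
DERIVED): GZK; `#E(ℚ)[p] = 1`; `s₁, s₂ ∈ Sel^(p)(E/ℚ)` `𝔽_p`-independent (`hind0`: two distinct
members of the front's EXACT basis) with LIFTS `z₁, z₂ ∈ Sel^(p²)(E/ℚ)`; `ord_p #Ш_an ≤ 4`. Per pair.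
[cite: Creutz2014, §1] [cite: SilvermanAEC2009, Thm. X.4.2(a)] [cite: Miller2011LMS, Def. 1.1] -/
theorem missingLowerBoundAt_of_two_selmerZSMul_eq_rankZero
    (hGZK : rank_eq_analyticRank_of_analyticRank_le_one) (hr : W.analyticRank = 0)
    (htors : Nat.card (AddSubgroup.torsionBy W.toAffine.Point (p : ℤ)) = 1)
    {s₁ s₂ : W.selmerGroup (p : ℤ)}
    (hind0 : ∀ a b : ℤ, a • s₁ + b • s₂ = 0 → (p : ℤ) ∣ a ∧ (p : ℤ) ∣ b)
    {hm : ((p ^ 2 : ℕ) : ℤ) ∣ (p : ℤ) * (p : ℤ)} {z₁ z₂ : W.selmerGroup ((p ^ 2 : ℕ) : ℤ)}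
    (hz₁ : W.selmerZSMul (p : ℤ) hm z₁ = s₁) (hz₂ : W.selmerZSMul (p : ℤ) hm z₂ = s₂)
    {q : ℚ} (hq : shaAn W = (q : ℂ)) (hv : padicValRat p q ≤ 4) : MissingLowerBoundAt W p := by
  refine missingLowerBoundAt_of_two_nonempty_selmer_rankZero W p hGZK hr htors s₁.2 s₂.2
    (fun a b hab ↦ hind0 a b ?_) (W.coe_selmerToSha (p : ℤ) s₁) (W.coe_selmerToSha (p : ℤ) s₂)
    (nsmul_selmerToSha_sq_eq_of_selmerZSMul_eq W p hz₁)
    (nsmul_selmerToSha_sq_eq_of_selmerZSMul_eq W p hz₂) hq hv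
  apply Subtype.ext
  simpa using hab

/-- **`NONEMPTY × 2` at Selmer level with the Mordell–Weil line, `r_an ≤ 1`, NO Cassels–Tate ⇒
the typed LOWER half** (= `missingLowerBoundAt_of_two_nonempty_selmer_mwLine`, GEN 17, classes
DERIVED): `hM` = the Mordell–Weil part of `Sel^(p)` inside `ℤ∙δ` (at `r_an = 1`, `#E(ℚ)[p] = 1`:
`selmerGroup_inf_ker_le_zmultiples_of_analyticRank_eq_one` with ANY located `δ = κ(P) ≠ 0`); `hind3`
= JOINT independence of `s₁, s₂, δ` (rule F-MW-JOINT); lifts `z₁, z₂ ∈ Sel^(p²)(E/ℚ)`; `ord_p #Ш_an ≤ 4`.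
[cite: Creutz2014, §1] [cite: SilvermanAEC2009, Thm. X.4.2(a)] [cite: Miller2011LMS, Def. 1.1] -/
theorem missingLowerBoundAt_of_two_selmerZSMul_eq_mwLine
    (hGZK : rank_eq_analyticRank_of_analyticRank_le_one) (hr : W.analyticRank ≤ 1)
    {δ : W.galH1Torsion (p : ℤ)}
    (hM : W.selmerGroup (p : ℤ) ⊓ (W.torsionH1ToH1 (p : ℤ)).ker ≤ AddSubgroup.zmultiples δ)
    {s₁ s₂ : W.selmerGroup (p : ℤ)}
    (hind3 : ∀ a b m : ℤ, a • (s₁ : W.galH1Torsion (p : ℤ)) + b • (s₂ : W.galH1Torsion (p : ℤ)) =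
      m • δ → (p : ℤ) ∣ a ∧ (p : ℤ) ∣ b)
    {hm : ((p ^ 2 : ℕ) : ℤ) ∣ (p : ℤ) * (p : ℤ)} {z₁ z₂ : W.selmerGroup ((p ^ 2 : ℕ) : ℤ)}
    (hz₁ : W.selmerZSMul (p : ℤ) hm z₁ = s₁) (hz₂ : W.selmerZSMul (p : ℤ) hm z₂ = s₂)
    {q : ℚ} (hq : shaAn W = (q : ℂ)) (hv : padicValRat p q ≤ 4) : MissingLowerBoundAt W p :=
  missingLowerBoundAt_of_two_nonempty_selmer_mwLine W p hGZK hr hM s₁.2 s₂.2 hind3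
    (W.coe_selmerToSha (p : ℤ) s₁) (W.coe_selmerToSha (p : ℤ) s₂)
    (nsmul_selmerToSha_sq_eq_of_selmerZSMul_eq W p hz₁)
    (nsmul_selmerToSha_sq_eq_of_selmerZSMul_eq W p hz₂) hq hv

end OverQ

/-! ### §4. `p = 3`: the record shapes with literal levels `3 ∣ 9` -/

section Three

/-- Arithmetic side condition `9 ∣ 3·3` for `[3]_* : Sel^(9) → Sel^(3)` (content-free). -/
theorem nine_dvd_three_mul_three : (9 : ℤ) ∣ 3 * 3 := by norm_num

variable (W : WeierstrassCurve ℚ) [W.IsElliptic]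

/-- **EXACT `EMPTY` at Selmer level, `p = 3`, literal levels**: `s ∈ Sel^(3)(E/ℚ)` with NO
`z ∈ Sel^(9)(E/ℚ)`, `[3]_* z = s` ⇒ `∀ w ∈ Ш(E/ℚ), 3 • w ≠ π₃ s` (the binder `hndiv` of the `p = 3`
`EMPTY` shapes) — and `3 • π₃ s = 0` (the binder `h3c`). [cite: Creutz2014, §1]
[cite: SilvermanAEC2009, Thm. X.4.2(a)] -/
theorem Three.forall_nsmul_ne_selmerToSha_of_not_exists_selmerZSMul_eq {hm : (9 : ℤ) ∣ 3 * 3}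
    {s : W.selmerGroup (3 : ℤ)} (hs : ¬ ∃ z : W.selmerGroup (9 : ℤ), W.selmerZSMul 3 hm z = s) :
    (3 • W.selmerToSha 3 s = 0) ∧ ∀ w : W.sha, 3 • w ≠ W.selmerToSha 3 s := by
  refine ⟨?_, fun w ↦ ?_⟩
  · have h := W.zsmul_selmerToSha 3 s
    rwa [ofNat_zsmul] at h
  · rw [← ofNat_zsmul]
    exact forall_zsmul_ne_selmerToSha_of_not_exists_selmerZSMul_eq W (by norm_num) (by norm_num) hs w

/-- **`r_an = 0`, `p = 3`, `E[3]` irreducible, `#Sel^(3)(E/ℚ) = 9` (EXACT) + ONE `s ∈ Sel^(3)(E/ℚ)`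
outside `[3]_* Sel^(9)(E/ℚ)` (EXACT `EMPTY` on its cubic) + Cassels–Tate + `ord₃ #Ш_an = 2` ⇒
`BSD(E,3)`** — the RUNBOOK §5 reading (N11 window atoms, X10a′) with the verdict binder on the
engine's own object (= `bsdp_three_rankZero_…_of_not_divisible` with `c := π₃ s`). Per pair.
[cite: Creutz2014, §1] [cite: SilvermanAEC2009, Thm. X.4.2(a) and Thm. X.4.14] [cite: Miller2011LMS, Def. 1.1] -/
theorem Three.bsdp_three_rankZero_of_card_selmerThree_eq_nine_of_casselsTate_of_not_exists_selmerZSMul_eq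
    (hGZK : rank_eq_analyticRank_of_analyticRank_le_one)
    (hCT : exists_casselsTate_pairing (K := ℚ)) (hr : W.analyticRank = 0) (hirr : Irr W 3)
    (h3 : Nat.card (W.selmerGroup (3 : ℤ)) = 9) {hm : (9 : ℤ) ∣ 3 * 3} (s : W.selmerGroup (3 : ℤ))
    (hs : ¬ ∃ z : W.selmerGroup (9 : ℤ), W.selmerZSMul 3 hm z = s)
    {q : ℚ} (hq : shaAn W = (q : ℂ)) (hv : padicValRat 3 q = 2) : BSDp W 3 :=
  bsdp_three_rankZero_of_card_selmerThree_eq_nine_of_casselsTate_of_not_divisible hGZK hCT W hr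
    hirr h3 (Three.forall_nsmul_ne_selmerToSha_of_not_exists_selmerZSMul_eq W hs).1
    (Three.forall_nsmul_ne_selmerToSha_of_not_exists_selmerZSMul_eq W hs).2 hq hv

/-- **X11 at `p = 3`, `r_an = 1` (`IsX11Three W`), `#Sel^(3)(E/ℚ) = 27` (EXACT) + ONE `s ∈ Sel^(3)(E/ℚ)`
outside `[3]_* Sel^(9)(E/ℚ)` + Cassels–Tate + `ord₃ #Ш_an = 2` ⇒ `BSD(E,3)`** (=
`Three.bsdp_three_of_card_selmerThree_eq_27_…_of_not_divisible` with `c := π₃ s`; targets: X11b@3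
seven, ADDP3 R1-SHA2, none run). NO Mordell–Weil / admissibility datum: `EMPTY` forces `π₃ s ≠ 0`.
Per pair; X11 ∧ `r = 1` ∧ `p = 3` stays CONSTRUCTION-SHAPED. [cite: Creutz2014, §1]
[cite: SilvermanAEC2009, Thm. X.4.2(a) and Thm. X.4.14] [cite: Miller2011LMS, §1 and Def. 1.1] -/
theorem Three.bsdp_three_of_card_selmerThree_eq_27_of_casselsTate_of_not_exists_selmerZSMul_eq
    (hGZK : rank_eq_analyticRank_of_analyticRank_le_one)
    (hCT : exists_casselsTate_pairing (K := ℚ)) (hX : IsX11Three W)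
    (h3 : Nat.card (W.selmerGroup (3 : ℤ)) = 27) {hm : (9 : ℤ) ∣ 3 * 3} (s : W.selmerGroup (3 : ℤ))
    (hs : ¬ ∃ z : W.selmerGroup (9 : ℤ), W.selmerZSMul 3 hm z = s)
    {q : ℚ} (hq : shaAn W = (q : ℂ)) (hv : padicValRat 3 q = 2) : BSDp W 3 :=
  Three.bsdp_three_of_card_selmerThree_eq_27_of_casselsTate_of_not_divisible hGZK hCT W hX h3
    (Three.forall_nsmul_ne_selmerToSha_of_not_exists_selmerZSMul_eq W hs).1
    (Three.forall_nsmul_ne_selmerToSha_of_not_exists_selmerZSMul_eq W hs).2 hq hv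

omit [W.IsElliptic] in
/-- **`NONEMPTY(witness)` at Selmer level, `p = 3`, literal levels**: `z ∈ Sel^(9)(E/ℚ)` with
`[3]_* z = s` gives `3 • π₉ z = π₃ s` — the binder `hd : 3 • d = c` of every `p = 3` `NONEMPTY`
shape, with `d := π₉ z`. [cite: Creutz2014, §1] [cite: SilvermanAEC2009, Thm. X.4.2(a)] -/
theorem Three.nsmul_selmerToSha_nine_eq_of_selmerZSMul_eq {hm : (9 : ℤ) ∣ 3 * 3}
    {z : W.selmerGroup (9 : ℤ)} {s : W.selmerGroup (3 : ℤ)} (hz : W.selmerZSMul 3 hm z = s) :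
    3 • W.selmerToSha 9 z = W.selmerToSha 3 s := by
  rw [← ofNat_zsmul]
  exact zsmul_selmerToSha_eq_of_selmerZSMul_eq W hz

/-- **X8 ∩ `r_an = 0` ∩ surj(3), `NONEMPTY × 2` at Selmer level, NO Cassels–Tate ⇒ `BSD(E,3)`** —
the class pattern (Wuthrich `hW`, GZK, `hmod`; two `𝔽₃`-independent `s₁, s₂ ∈ Sel^(3)(E/ℚ)` with
lifts `z₁, z₂ ∈ Sel^(9)(E/ℚ)`; `ord₃ #Ш_an ≤ 4`); X7 / X6 / X4-Kato / X4(M) are fed the same way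
through `missingLowerBoundAt_of_two_selmerZSMul_eq_rankZero`. Per pair; nothing booked.
[cite: Wuthrich2014, Prop. 21] [cite: Creutz2014, §1] [cite: SilvermanAEC2009, Thm. X.4.2(a)] -/
theorem X8.bsdp_three_rankZero_of_two_selmerZSMul_eq_of_surj (hW : sha_dvd_analyticSha)
    (hGZK : rank_eq_analyticRank_of_analyticRank_le_one) (hmod : hasEntireLFunction_rat)
    [W.IsGloballyMinimal] (hX : ClassX8 W 3) (hs : Surj W 3) (hr : W.analyticRank = 0)
    {s₁ s₂ : W.selmerGroup (3 : ℤ)}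
    (hind0 : ∀ a b : ℤ, a • s₁ + b • s₂ = 0 → (3 : ℤ) ∣ a ∧ (3 : ℤ) ∣ b)
    {hm : (9 : ℤ) ∣ 3 * 3} {z₁ z₂ : W.selmerGroup (9 : ℤ)}
    (hz₁ : W.selmerZSMul 3 hm z₁ = s₁) (hz₂ : W.selmerZSMul 3 hm z₂ = s₂)
    {q : ℚ} (hq : shaAn W = (q : ℂ)) (hv : padicValRat 3 q ≤ 4) : BSDp W 3 := by
  have htors : Nat.card (AddSubgroup.torsionBy W.toAffine.Point ((3 : ℕ) : ℤ)) = 1 :=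
    natCard_torsionBy_eq_one_of_hasIrreducibleModPGaloisRep W 3
      (hasIrreducibleModPGaloisRep_of_hasSurjectiveModNGaloisRep W 3 hs)
  refine X8.bsdp_of_missingLowerBoundAt_of_surj W 3 hW hGZK hmod hX hs hr
    (missingLowerBoundAt_of_two_nonempty_selmer_rankZero W 3 hGZK hr htors s₁.2 s₂.2
      (fun a b hab ↦ hind0 a b ?_) (W.coe_selmerToSha 3 s₁) (W.coe_selmerToSha 3 s₂)
      (Three.nsmul_selmerToSha_nine_eq_of_selmerZSMul_eq W hz₁)
      (Three.nsmul_selmerToSha_nine_eq_of_selmerZSMul_eq W hz₂) hq hv)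
  apply Subtype.ext
  simpa using hab

end Three

end Summit.BirchSwinnertonDyer.Rank1Residual.SecondDescent

end
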